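import Summits.QuantumAdvantage.QuantumAdvantage.Theses.ThirdFactorialPincer
import Literature.NumberTheory.QuadraticFields.ChowlaCentralFactorialProofs

/-!
# QuantumAdvantage / ThirdFactorialPincer — `JacobiCube` (stmt-QuantumAdvantage-11647), part 1: lemmas

**Jacobi (1837) / Gauss.** For a prime `p ≡ 1 (mod 3)` there are integers `L, M` with
`4p = L² + 27M²` and `L ≡ 1 (mod 3)`; such an `L` is unique, and with `K = (p − 1)/3`
`(K!)³ · L ≡ (−1)^K (mod p)`.

This file holds the elementary lemmas (uniqueness of `L`; `ω`; class sums; power sums, the two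
binomial sums and Wilson in `𝔽_p`; the power sums `Σ_x x^e` are the tree's
`ChowlaProof.sum_pow_eq_zero_of_lt` / `sum_pow_card_sub_one`); the Jacobi-sum core and the theorem are in the sequel
`ThirdFactorialPincerJacobiCube.lean`. Proof (kernel-checked, classical route through Jacobi sums; Ireland–Rosen Ch. 8 §§3–4,
Ch. 9 §§4–6; Berndt–Evans–Williams Thm 2.1.5 / 3.1.3):

* Let `g` generate `(ℤ/p)ˣ`, `ω = e^{2πi/3}`, `χ` the cubic character with `χ(g) = ω`
  (Mathlib `MulChar.ofRootOfUnity`), `ρ = g^K ∈ 𝔽_p` (so `x^K = ρ^n` when `χ(x) = ω^n`), and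
  `J = J(χ, χ) = Σ_x χ(x) χ(1 − x)` (Mathlib `jacobiSum`). Sorting `x ∉ {0, 1}` by the class
  `c(x) ∈ {0,1,2}` of `χ(x)χ(1−x) = ω^{c(x)}` with counts `N₀, N₁, N₂` gives
  `J = a + bω` with `a = N₀ − N₂`, `b = N₁ − N₂`, `J̄ = (a − b) − bω`, and in `𝔽_p`
  `Σ_x x^K (1−x)^K = a + bρ`, `Σ_x x^{2K} (1−x)^{2K} = (a − b) − bρ`.
* `J · J̄ = p` (Mathlib `jacobiSum_mul_jacobiSum_inv` and `star χ = χ⁻¹`), i.e.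
  `a² − ab + b² = p`; `J ≡ −1 (mod (1 − ω)²)` (Mathlib `exists_jacobiSum_eq_neg_one_add`) gives
  `a ≡ −1`, `b ≡ 0 (mod 3)`; hence `L := 2a − b ≡ 1 (mod 3)`, `M := b/3`, `4p = L² + 27M²`.
* Binomial expansion and the power sums `Σ_{x ∈ 𝔽_p} x^e` (`= −1` if `p − 1 ∣ e > 0`, else `0`)
  give `Σ x^K(1−x)^K = 0` and `Σ x^{2K}(1−x)^{2K} = −(−1)^K C(2K, K) = −C(2K,K)` (`K` is even);
  adding, `L ≡ 2a − b ≡ −C(2K, K) (mod p)` (Jacobi's binomial congruence).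
* Wilson: `−1 ≡ (3K)! ≡ (−1)^K C(2K,K) (K!)³`, so `(K!)³ L ≡ (−1)^K`.
* Uniqueness of `L` (elementary): if also `4p = L'² + 27M'²`, `L' ≡ 1 (3)`, then with
  `A = LL' ± 27MM'`, `B = LM' ∓ L'M`, `A² + 27B² = 16p²` and `p ∣ A` for one sign, forcing
  `B = 0`, `L'² = L²`, `L' = L`.

HONEST FRAMING (block-2b rule): the value here is a closed ledger item (a classical theorem,
kernel-checked), not summit progress.

References: K. Ireland, M. Rosen, *A Classical Introduction to Modern Number Theory*, GTM 84
(1990), Ch. 8 §3 (Jacobi sums), Ch. 9 §4 (cubic primary normalisation) [IrelandRosen1990];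
B. C. Berndt, R. J. Evans, K. S. Williams, *Gauss and Jacobi Sums* (1998), Thm 2.1.5, §3.1
[BerndtEvans1981]; R. H. Hudson, K. S. Williams, Trans. AMS 281 (1984) 431–505
(binomial coefficients and Jacobi sums) [HudsonWilliams1984].
-/

set_option linter.dupNamespace false -- D-0017: single-problem summit ⇒ `QuantumAdvantage.QuantumAdvantage` by design

namespace Summit.QuantumAdvantage.QuantumAdvantage.Theorems.JacobiCube

open Finset
open Literature.NumberTheory.QuadraticFields.ChowlaProof (sum_pow_eq_zero_of_lt sum_pow_card_sub_one)

/-! ### Part U — uniqueness of `L` in `4p = L² + 27M²`, `L ≡ 1 (mod 3)` -/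

/-- If `X² + 27Y² = 16p²` with `p ∣ X` and `p ≡ 1 (mod 3)` (so `3 ∤ p`), then `Y = 0`.
[folklore] -/
theorem eq_zero_of_sq_add {p X Y : ℤ} (hp3 : p % 3 = 1) (h : X ^ 2 + 27 * Y ^ 2 = 16 * p ^ 2)
    (hX : p ∣ X) : Y = 0 := by
  obtain ⟨k, rfl⟩ := hX
  -- `27 Y² = p² (16 − k²)`, so `k² ≤ 16`
  have hp0 : p ≠ 0 := by rintro rfl; omega
  have hp2 : 0 < p ^ 2 := by positivity
  have hk : k ^ 2 ≤ 16 := by nlinarith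
  have hk1 : -4 ≤ k := by nlinarith
  have hk2 : k ≤ 4 := by nlinarith
  obtain ⟨m, hm⟩ : ∃ m : ℤ, p = 3 * m + 1 := ⟨p / 3, by omega⟩
  obtain ⟨w, hp2w⟩ : ∃ w : ℤ, p ^ 2 = 3 * w + 1 := ⟨3 * m ^ 2 + 2 * m, by rw [hm]; ring⟩
  have key : 27 * Y ^ 2 = (16 - k ^ 2) * (3 * w + 1) := by rw [← hp2w]; linear_combination h
  have hYy : Y ^ 2 = 0 → Y = 0 := fun h0 => pow_eq_zero_iff (two_ne_zero) |>.1 h0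
  generalize Y ^ 2 = y at key hYy
  clear h hk hm hp2w hp2
  interval_cases k <;> norm_num at key <;> omega

/-- **Uniqueness of `L`.** If `4p = L² + 27M² = L'² + 27M'²` with `L ≡ L' ≡ 1 (mod 3)` and
`p ≡ 1 (mod 3)`, then `L = L'`. [Ireland–Rosen 1990, Prop. 8.3.2] [folklore] -/
theorem L_unique {p L M L' M' : ℤ} (hp3 : p % 3 = 1) (hprime : Prime p)
    (h : 4 * p = L ^ 2 + 27 * M ^ 2) (h' : 4 * p = L' ^ 2 + 27 * M' ^ 2)
    (hL : L % 3 = 1) (hL' : L' % 3 = 1) : L = L' := by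
  -- the two composition identities
  have hAB : (L * L' + 27 * M * M') ^ 2 + 27 * (L * M' - L' * M) ^ 2 = 16 * p ^ 2 := by
    have : (L ^ 2 + 27 * M ^ 2) * (L' ^ 2 + 27 * M' ^ 2) = (4 * p) * (4 * p) := by rw [← h, ← h']
    linear_combination this
  have hCD : (L * L' - 27 * M * M') ^ 2 + 27 * (L * M' + L' * M) ^ 2 = 16 * p ^ 2 := by
    have : (L ^ 2 + 27 * M ^ 2) * (L' ^ 2 + 27 * M' ^ 2) = (4 * p) * (4 * p) := by rw [← h, ← h']
    linear_combination this
  -- `p` divides the product `A · C`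
  have hAC : p ∣ (L * L' + 27 * M * M') * (L * L' - 27 * M * M') := by
    have : (L * L' + 27 * M * M') * (L * L' - 27 * M * M') =
        p * (4 * L' ^ 2 - 108 * M ^ 2) + L' ^ 2 * (L ^ 2 + 27 * M ^ 2 - 4 * p)
          - 27 * M ^ 2 * (L' ^ 2 + 27 * M' ^ 2 - 4 * p) := by ring
    rw [this, show L ^ 2 + 27 * M ^ 2 - 4 * p = 0 by linarith,
      show L' ^ 2 + 27 * M' ^ 2 - 4 * p = 0 by linarith]
    simp
  -- in either case the `B`-coordinate vanishes, whence `L'² M² = L² M'²`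
  have hsq : L' ^ 2 * M ^ 2 = L ^ 2 * M' ^ 2 := by
    rcases hprime.dvd_or_dvd hAC with hA | hC
    · have hB := eq_zero_of_sq_add hp3 hAB hA
      have : L * M' = L' * M := by linarith
      linear_combination (-(L * M' + L' * M)) * this
    · have hD := eq_zero_of_sq_add hp3 hCD hC
      have : L * M' = -(L' * M) := by linarith
      linear_combination (L' * M - L * M') * this
  -- multiply the two representations
  have hLL : L' ^ 2 = L ^ 2 := by
    have e : L' ^ 2 * (L ^ 2 + 27 * M ^ 2) = L ^ 2 * (L' ^ 2 + 27 * M' ^ 2) := by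
      linear_combination 27 * hsq
    rw [← h, ← h'] at e
    have hp0 : (4 : ℤ) * p ≠ 0 := by
      have := hprime.ne_zero
      positivity
    exact mul_right_cancel₀ hp0 e
  rcases sq_eq_sq_iff_eq_or_eq_neg.1 hLL with h1 | h1 <;> omega

/-! ### Part Ω — a primitive cube root of unity `ω` in `ℂ` and the normal form `a + bω` -/

section Omega

variable {ω : ℂ} (hω : IsPrimitiveRoot ω 3)
include hω

/-- `ω² + ω + 1 = 0`. [folklore] -/
theorem ω_sq_add : ω ^ 2 + ω + 1 = 0 := by
  have h := hω.geom_sum_eq_zero (by norm_num : 1 < 3)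
  simp only [Finset.sum_range_succ, Finset.sum_range_zero, pow_zero, pow_one, zero_add] at h
  linear_combination h

/-- `ω̄ = ω²` (`|ω| = 1`). [folklore] -/
theorem conj_ω : starRingEnd ℂ ω = ω ^ 2 := by
  have h1 : ‖ω‖ = 1 := hω.norm'_eq_one (by norm_num)
  rw [← Complex.inv_eq_conj h1]
  have : ω * ω ^ 2 = 1 := by rw [← pow_succ', hω.pow_eq_one]
  exact (eq_inv_of_mul_eq_one_right this).symm ▸ rfl

/-- `ω` is not real (a real cube root of unity is `1`). [folklore] -/
theorem ω_im_ne_zero : ω.im ≠ 0 := by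
  intro him
  have hω1 : ω ≠ 1 := hω.ne_one (by norm_num)
  have h3 : ω ^ 3 = 1 := hω.pow_eq_one
  -- `ω` is real: `ω = x` with `x³ = 1`, so `(x − 1)(x² + x + 1) = 0` and `x² + x + 1 > 0`
  set x : ℝ := ω.re with hx
  have hωx : ω = (x : ℂ) := Complex.ext (by simp [hx]) (by simp [him])
  have hx3 : x ^ 3 = 1 := by
    have := h3
    rw [hωx] at this
    exact_mod_cast this
  have hx1 : x ≠ 1 := by
    intro h
    apply hω1
    rw [hωx, h]
    norm_num
  have hfac : (x - 1) * (x ^ 2 + x + 1) = 0 := by linear_combination hx3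
  rcases mul_eq_zero.1 hfac with h | h
  · exact hx1 (by linarith)
  · nlinarith [sq_nonneg (x + 1 / 2)]

/-- Uniqueness of the normal form `a + bω` (`1, ω` are `ℝ`-linearly independent). [folklore] -/
theorem nf_unique {a b a' b' : ℤ} (h : (a : ℂ) + b * ω = a' + b' * ω) : a = a' ∧ b = b' := by
  have him := congrArg Complex.im h
  have hre := congrArg Complex.re h
  simp only [Complex.add_im, Complex.intCast_im, Complex.mul_im, Complex.intCast_re, zero_mul,
    add_zero, zero_add] at him
  have hb : b = b' := by
    have : ((b : ℝ) - b') * ω.im = 0 := by linarith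
    rcases mul_eq_zero.1 this with h0 | h0
    · exact_mod_cast sub_eq_zero.1 h0
    · exact absurd h0 (ω_im_ne_zero hω)
  subst hb
  simp only [Complex.add_re, Complex.intCast_re, Complex.mul_re, Complex.intCast_im, zero_mul,
    sub_zero, add_left_inj] at hre
  exact ⟨by exact_mod_cast hre, rfl⟩

/-- Every element of `ℤ[ω] = Algebra.adjoin ℤ {ω}` has the form `a + bω`. [folklore] -/
theorem nf_exists {z : ℂ} (hz : z ∈ Algebra.adjoin ℤ ({ω} : Set ℂ)) :
    ∃ a b : ℤ, z = a + b * ω := by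
  induction hz using Algebra.adjoin_induction with
  | mem x hx =>
    rw [Set.mem_singleton_iff] at hx
    exact ⟨0, 1, by simp [hx]⟩
  | algebraMap r => exact ⟨r, 0, by simp⟩
  | add x y _ _ hx hy =>
    obtain ⟨a, b, rfl⟩ := hx
    obtain ⟨c, d, rfl⟩ := hy
    exact ⟨a + c, b + d, by push_cast; ring⟩
  | mul x y _ _ hx hy =>
    obtain ⟨a, b, rfl⟩ := hx
    obtain ⟨c, d, rfl⟩ := hy
    refine ⟨a * c - b * d, a * d + b * c - b * d, ?_⟩
    push_cast
    linear_combination (b * d : ℂ) * ω_sq_add hω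

end Omega

/-! ### Part Σ — a sum over three classes -/

/-- A sum of `g ∘ f` over a finite set on which `f` takes values `< 3`, sorted by the value of
`f`. [folklore] -/
theorem sum_three_classes {ι R : Type*} [AddCommMonoid R] (S : Finset ι) (f : ι → ℕ)
    (hf : ∀ x ∈ S, f x < 3) (g : ℕ → R) :
    ∑ x ∈ S, g (f x) = (S.filter fun x => f x = 0).card • g 0 +
      (S.filter fun x => f x = 1).card • g 1 + (S.filter fun x => f x = 2).card • g 2 := by
  rw [← Finset.sum_fiberwise_of_maps_to (g := f) (t := Finset.range 3)
    (fun x hx => Finset.mem_range.2 (hf x hx))]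
  have hin : ∀ m, ∑ x ∈ S with f x = m, g (f x) = (S.filter fun x => f x = m).card • g m := by
    intro m
    rw [Finset.sum_congr rfl (fun x hx => by rw [(Finset.mem_filter.1 hx).2]), Finset.sum_const]
  simp only [hin, Finset.sum_range_succ, Finset.sum_range_zero, zero_add]

/-! ### Part 𝔽_p — power sums, the two binomial sums, Wilson -/

section ZModFacts

variable {p : ℕ} [hp : Fact p.Prime]

/-- `Σ_{x ∈ 𝔽_p} x^{(p−1)+e} = Σ_{x ∈ 𝔽_p} x^e` for `e > 0`. [folklore] -/
theorem sum_pow_add_card_sub_one {e : ℕ} (he : 0 < e) :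
    ∑ x : ZMod p, x ^ (p - 1 + e) = ∑ x : ZMod p, x ^ e := by
  refine Finset.sum_congr rfl fun x _ => ?_
  rcases eq_or_ne x 0 with rfl | hx
  · rw [zero_pow he.ne', zero_pow (by omega)]
  · rw [pow_add, ZMod.pow_card_sub_one_eq_one hx, one_mul]

/-- `Σ_x x^K (1 − x)^K = 0` in `𝔽_p` when `3K = p − 1`, `K > 0` (all exponents `K … 2K` are
strictly between `0` and `p − 1`). [folklore] -/
theorem sum_binom_K {K : ℕ} (hK : 3 * K = p - 1) (hK0 : 0 < K) :
    ∑ x : ZMod p, x ^ K * (1 - x) ^ K = 0 := by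
  have hexp : ∀ x : ZMod p, x ^ K * (1 - x) ^ K =
      ∑ m ∈ Finset.range (K + 1), ((-1) ^ (K - m) * (K.choose m : ZMod p)) * x ^ (2 * K - m) := by
    intro x
    rw [sub_eq_add_neg, add_pow, Finset.mul_sum]
    refine Finset.sum_congr rfl fun m hm => ?_
    rw [Finset.mem_range] at hm
    rw [one_pow, one_mul, neg_pow, show 2 * K - m = K + (K - m) by omega, pow_add]
    ring
  simp_rw [hexp]
  rw [Finset.sum_comm]
  refine Finset.sum_eq_zero fun m hm => ?_
  rw [Finset.mem_range] at hm
  rw [← Finset.mul_sum, sum_pow_eq_zero_of_lt (by omega), mul_zero]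

/-- `Σ_x x^{2K} (1 − x)^{2K} = −(−1)^K · C(2K, K)` in `𝔽_p` when `3K = p − 1`, `K > 0`
(only the middle binomial term has exponent `3K = p − 1`). [folklore] -/
theorem sum_binom_2K {K : ℕ} (hK : 3 * K = p - 1) (hK0 : 0 < K) :
    ∑ x : ZMod p, x ^ (2 * K) * (1 - x) ^ (2 * K) =
      -((-1) ^ K * ((2 * K).choose K : ZMod p)) := by
  have hexp : ∀ x : ZMod p, x ^ (2 * K) * (1 - x) ^ (2 * K) =
      ∑ m ∈ Finset.range (2 * K + 1),
        ((-1) ^ (2 * K - m) * ((2 * K).choose m : ZMod p)) * x ^ (4 * K - m) := by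
    intro x
    rw [sub_eq_add_neg, add_pow, Finset.mul_sum]
    refine Finset.sum_congr rfl fun m hm => ?_
    rw [Finset.mem_range] at hm
    rw [one_pow, one_mul, neg_pow, show 4 * K - m = 2 * K + (2 * K - m) by omega, pow_add]
    ring
  simp_rw [hexp]
  rw [Finset.sum_comm, Finset.sum_eq_single K]
  · rw [← Finset.mul_sum, show 4 * K - K = p - 1 by omega, sum_pow_card_sub_one,
      show 2 * K - K = K by omega]
    ring
  · intro m hm hmK
    rw [Finset.mem_range] at hm
    rw [← Finset.mul_sum]
    rcases lt_or_gt_of_ne hmK with h | h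
    · rw [show 4 * K - m = p - 1 + (K - m) by omega, sum_pow_add_card_sub_one (by omega),
        sum_pow_eq_zero_of_lt (by omega), mul_zero]
    · rw [sum_pow_eq_zero_of_lt (by omega), mul_zero]
  · intro h
    exact absurd (Finset.mem_range.2 (by omega)) h

/-- **Wilson, cubed.** `(K!)³ · C(2K, K) · (−1)^K = −1` in `𝔽_p` when `3K = p − 1`:
`(3K)! = (2K)! · ∏_{i<K} (2K+1+i)`, `(2K)! = C(2K,K)(K!)²`, `2K+1+i ≡ −(K−i)`. [folklore] -/
theorem wilson_cube {K : ℕ} (hK : 3 * K = p - 1) :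
    ((K.factorial : ℕ) : ZMod p) ^ 3 * ((2 * K).choose K : ZMod p) * (-1) ^ K = -1 := by
  have hW : (((3 * K).factorial : ℕ) : ZMod p) = -1 := by
    rw [hK]
    exact ZMod.wilsons_lemma p
  have h1 : (3 * K).factorial = (2 * K).factorial * ∏ i ∈ Finset.range K, (2 * K + 1 + i) := by
    rw [← Nat.ascFactorial_eq_prod_range, Nat.factorial_mul_ascFactorial,
      show 2 * K + K = 3 * K by ring]
  have h2 : (2 * K).factorial = (2 * K).choose K * K.factorial * K.factorial := by
    have h := Nat.choose_mul_factorial_mul_factorial (n := 2 * K) (k := K) (by omega)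
    rw [show 2 * K - K = K by omega] at h
    exact h.symm
  have h3 : (((∏ i ∈ Finset.range K, (2 * K + 1 + i) : ℕ)) : ZMod p) =
      (-1) ^ K * (K.factorial : ZMod p) := by
    rw [Nat.cast_prod]
    have h : ∀ i ∈ Finset.range K, ((2 * K + 1 + i : ℕ) : ZMod p) = -((K - i : ℕ) : ZMod p) := by
      intro i hi
      rw [Finset.mem_range] at hi
      rw [eq_neg_iff_add_eq_zero, ← Nat.cast_add, show 2 * K + 1 + i + (K - i) = p by omega,
        ZMod.natCast_self]
    rw [Finset.prod_congr rfl h, Finset.prod_neg, Finset.card_range, ← Nat.cast_prod,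
      ← Nat.descFactorial_eq_prod_range, Nat.descFactorial_self]
  have h4 : (((3 * K).factorial : ℕ) : ZMod p) =
      ((K.factorial : ℕ) : ZMod p) ^ 3 * ((2 * K).choose K : ZMod p) * (-1) ^ K := by
    rw [h1, h2]
    simp only [Nat.cast_mul]
    rw [h3]
    ring
  rw [← h4, hW]

end ZModFacts

end Summit.QuantumAdvantage.QuantumAdvantage.Theorems.JacobiCube
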